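import Mathlib.Analysis.Fourier.AddCircle
import Mathlib.Analysis.SpecialFunctions.Trigonometric.Bounds
import Mathlib.Analysis.Complex.Exponential
import Mathlib.Analysis.Real.Pi.Bounds
import HarnessLib

/-!
# Truncated Fourier synthesis in `L²`: symmetric partial sums on `AddCircle T`, period integrals, and the monomial targets `u^m·𝟙_{[-1,1]}`

Splittings — x-wuc (xiv-d L1).  ζ-FREE, elementary, sorry-free `L²` Fourier-series bookkeeping (folklore METHODS, Mathlib only;
the packaging is the cell's) for quantitative SYNTHESIS statements «a target on `[−1,1]` is approximated in `L²` by a trigonometric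
polynomial with FEW and SMALL coefficients»; consumed by `Theorems/Splittings/NearLatticeFourierSynthesis.lean`.  Placed under
`Theorems/Splittings/` by the lead's RULING #66 (2026-08-27T09:31:16Z: the lemma is the cell's, not print).  Provenance: cell rh-split,
seat rh-split-x-wuc g7 (scratch `SplitXWucG7b.lean` d0583c86bc2d8ec7 §G7b Steps 1–5, verbatim; Mathlib-only replica
`NearLatticeSynthesisG7.lean` 851a838689e7c9fb); cut (xiv-d) L1, `cut7/make_cut7.py` v2.

* Step 1 `norm_sub_sum_inner_sq` — for an orthonormal family, `‖x − Σ_{i∈s} ⟪v i,x⟫ v i‖² = ‖x‖² − Σ_{i∈s} |⟪v i,x⟫|²`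
  (the identity inside Mathlib's proof of Bessel's inequality, stated as an equality);
* Step 2 `fourier_partial_sum_L2` — Parseval (`fourierBasis.repr` is an isometry onto `ℓ²(ℤ)`) ⇒ the SYMMETRIC partial sums
  `Σ_{|n|≤K} ⟪e_n,x⟫ e_n` converge to `x` in `L²(AddCircle T)`;
* Step 3 `Lp_two_norm_sq_eq_integral`, `memLp_lift`, `norm_sq_sub_trigPoly` — `T·‖liftIoc g − Σ c_n e_n‖² = ∫_{(a,a+T]} |g − Σ c_n e^{2πinu/T}|²`;
* Step 4 elementary inequalities: `norm_add_three_sq`, `norm_sum_mul_sq_le` (finite Cauchy–Schwarz), `norm_cexp_sub_cexp_le`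
  (`|e^{−iau} − e^{−ibu}| ≤ |a−b||u|`), `two_sinh_taylor` (`|2 sinh x − Σ_{m<n}(x^m − (−x)^m)/m!| ≤ 4·2^{−n}` on `|x| ≤ ½`), `sum_Icc_neg`;
* Step 5 the monomial targets `gm m = u^m·𝟙_{[-1,1]}`: measurability / `L²` membership / bounds, `continuous_trigPoly`,
  `integrableOn_gm_err`, and `gm_synthesis` — Fourier data `c` with Bessel budget `Σ_{|n|≤K} |c n|² ≤ 2/T` for every `K` and
  `L²((−T/2, T/2])`-convergence of the symmetric partial sums to `gm m`.
No instances, no notation, no named facts; nothing here bears on the truth of RH.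
-/

set_option linter.dupNamespace false

noncomputable section

open scoped ComplexConjugate
open Set Filter Topology Complex MeasureTheory AddCircle

namespace Summit.RiemannHypothesis.RiemannHypothesis.Theorems.Splittings.TruncatedFourierSynthesisL2

/-! ### Step 1. Orthonormal partial sums: `‖x − Σ ⟪vᵢ,x⟫ vᵢ‖² = ‖x‖² − Σ |⟪vᵢ,x⟫|²` (from Mathlib's Bessel proof) -/

/-- Orthonormal partial sums: `‖x − Σ_{i∈s} ⟪v i, x⟫ v i‖² = ‖x‖² − Σ_{i∈s} ‖⟪v i, x⟫‖²` (the identity inside Mathlib's Bessel proof). [folklore] -/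
theorem norm_sub_sum_inner_sq {𝕜 E : Type*} [RCLike 𝕜] [NormedAddCommGroup E] [InnerProductSpace 𝕜 E]
    {ι : Type*} {v : ι → E} (hv : Orthonormal 𝕜 v) (x : E) (s : Finset ι) :
    ‖x - ∑ i ∈ s, (inner 𝕜 (v i) x) • v i‖ ^ 2 = ‖x‖ ^ 2 - ∑ i ∈ s, ‖inner 𝕜 (v i) x‖ ^ 2 := by
  have h₂ : (∑ i ∈ s, ∑ j ∈ s, inner 𝕜 (v i) x * inner 𝕜 x (v j) * inner 𝕜 (v j) (v i)) =
      (∑ k ∈ s, inner 𝕜 (v k) x * inner 𝕜 x (v k) : 𝕜) := by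
    classical exact hv.inner_left_right_finset
  have h₃ : ∀ z : 𝕜, RCLike.re (z * conj z) = ‖z‖ ^ 2 := by
    intro z
    simp only [RCLike.mul_conj]
    norm_cast
  rw [@norm_sub_sq 𝕜, sub_add]
  simp only [@InnerProductSpace.norm_sq_eq_re_inner 𝕜 E, inner_sum, sum_inner]
  simp only [inner_smul_right, two_mul, inner_smul_left, inner_conj_symm, ← mul_assoc, h₂,
    add_sub_cancel_right, sub_right_inj]
  simp only [map_sum, ← inner_conj_symm x, ← h₃]

/-! ### Step 2. Parseval ⇒ symmetric Fourier partial sums converge in `L²(AddCircle T)` -/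

variable {T : ℝ} [hT : Fact (0 < T)]

/-- The `L²`-distance of `x` to its symmetric Fourier partial sum `Σ_{|n| ≤ K} ⟪e_n, x⟫ e_n` tends to `0`. -/
theorem fourier_partial_sum_L2 (x : Lp ℂ 2 (@haarAddCircle T hT)) {ε : ℝ} (hε : 0 < ε) :
    ∃ K₀ : ℕ, ∀ K : ℕ, K₀ ≤ K →
      ‖x - ∑ n ∈ Finset.Icc (-(K : ℤ)) K, (inner ℂ (fourierLp 2 n) x) • (fourierLp 2 n : Lp ℂ 2 haarAddCircle)‖ ^ 2
        < ε := by
  have H₁ : HasSum (fun i : ℤ ↦ ‖fourierBasis.repr x i‖ ^ 2) (‖fourierBasis.repr x‖ ^ 2) := by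
    apply_mod_cast lp.hasSum_norm ?_ (fourierBasis.repr x)
    simp
  have H₂ : ‖fourierBasis.repr x‖ ^ 2 = ‖x‖ ^ 2 := by simp
  rw [H₂] at H₁
  have hrepr : ∀ i : ℤ, (fourierBasis.repr x i : ℂ) = inner ℂ (fourierLp 2 i : Lp ℂ 2 haarAddCircle) x :=
    fun i ↦ by rw [HilbertBasis.repr_apply_apply, coe_fourierBasis]
  obtain ⟨F₀, hF₀⟩ := Metric.tendsto_atTop.1 H₁ ε hε
  refine ⟨F₀.sup Int.natAbs, fun K hK ↦ ?_⟩
  have hsub : F₀ ≤ Finset.Icc (-(K : ℤ)) K := by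
    intro n hn
    have h1 : n.natAbs ≤ K := (Finset.le_sup hn).trans hK
    rw [Finset.mem_Icc]
    omega
  have h := hF₀ _ hsub
  rw [Real.dist_eq] at h
  rw [norm_sub_sum_inner_sq orthonormal_fourier x]
  simp_rw [← hrepr]
  have := (abs_lt.1 h).1
  linarith

/-! ### Step 3. From `Lp` norms back to honest integrals -/

/-- For `y ∈ L²(μ; ℂ)`: `‖y‖² = ∫ ‖y a‖² dμ`. [folklore] -/
theorem Lp_two_norm_sq_eq_integral {α : Type*} [MeasurableSpace α] {μ : Measure α} (y : Lp ℂ 2 μ) :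
    ‖y‖ ^ 2 = ∫ t, ‖y t‖ ^ 2 ∂μ := by
  have H₃ := congr_arg RCLike.re (@L2.inner_def α ℂ ℂ _ _ _ _ _ y y)
  rw [← integral_re (L2.integrable_inner y y)] at H₃
  simp only [← norm_sq_eq_re_inner] at H₃
  exact H₃

/-- The `Lp` element of a function `g` on the period `(a, a+T]`. -/
theorem memLp_lift {a : ℝ} {g : ℝ → ℂ} (hg : MemLp g 2 (volume.restrict (Ioc a (a + T)))) :
    MemLp (AddCircle.liftIoc T a g) 2 (@haarAddCircle T hT) :=
  hg.memLp_liftIoc.haarAddCircle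

/-- **Translation lemma.**  For `g ∈ L²(a, a+T]` lifted to `x ∈ L²(AddCircle T)` and any trigonometric polynomial
`Σ_{n∈F} c_n e_n`:  `T · ‖x − Σ c_n e_n‖² = ∫_{(a,a+T]} |g(u) − Σ c_n e^{2πinu/T}|² du`. -/
theorem norm_sq_sub_trigPoly {a : ℝ} {g : ℝ → ℂ} (hg : MemLp g 2 (volume.restrict (Ioc a (a + T))))
    (F : Finset ℤ) (c : ℤ → ℂ) :
    T * ‖(memLp_lift hg).toLp _ - ∑ n ∈ F, c n • (fourierLp 2 n : Lp ℂ 2 (@haarAddCircle T hT))‖ ^ 2 =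
      ∫ u in Ioc a (a + T), ‖g u - ∑ n ∈ F, c n * Complex.exp (2 * Real.pi * I * n * u / T)‖ ^ 2 := by
  set y := (memLp_lift hg).toLp _ - ∑ n ∈ F, c n • (fourierLp 2 n : Lp ℂ 2 (@haarAddCircle T hT)) with hy
  -- the trigonometric polynomial as ONE continuous map
  set P : C(AddCircle T, ℂ) := ∑ n ∈ F, c n • fourier n with hP
  have hPsum : ∑ n ∈ F, c n • (fourierLp 2 n : Lp ℂ 2 (@haarAddCircle T hT)) =
      ContinuousMap.toLp 2 haarAddCircle ℂ P := by
    simp only [hP, map_sum, map_smul, fourierLp]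
  have hae : (y : AddCircle T → ℂ) =ᵐ[haarAddCircle] fun t ↦ AddCircle.liftIoc T a g t - P t := by
    rw [hy, hPsum]
    filter_upwards [Lp.coeFn_sub ((memLp_lift hg).toLp _) (ContinuousMap.toLp 2 haarAddCircle ℂ P),
      (memLp_lift hg).coeFn_toLp, ContinuousMap.coeFn_toLp (p := 2) (μ := haarAddCircle) (𝕜 := ℂ) P]
      with t h1 h2 h3
    rw [h1, Pi.sub_apply, h2, h3]
  have hint : ∫ t, ‖(y : AddCircle T → ℂ) t‖ ^ 2 ∂haarAddCircle =
      ∫ t, ‖AddCircle.liftIoc T a g t - P t‖ ^ 2 ∂haarAddCircle :=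
    integral_congr_ae (by filter_upwards [hae] with t ht; simp only [ht])
  rw [Lp_two_norm_sq_eq_integral, hint]
  -- now a plain integral over the circle; descend to the period
  have hlift : (fun t : AddCircle T ↦ ‖AddCircle.liftIoc T a g t - P t‖ ^ 2) =
      AddCircle.liftIoc T a (fun u ↦ ‖g u - ∑ n ∈ F, c n * Complex.exp (2 * Real.pi * I * n * u / T)‖ ^ 2) := by
    funext t
    obtain ⟨u, hu⟩ : ∃ u : Ioc a (a + T), (u : ℝ) = t := ⟨equivIoc T a t, coe_equivIoc⟩
    rw [← hu, liftIoc_coe_apply u.2, liftIoc_coe_apply u.2]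
    congr 2
    simp only [hP, ContinuousMap.coe_sum, ContinuousMap.coe_smul, Finset.sum_apply, Pi.smul_apply,
      smul_eq_mul, fourier_coe_apply]
  rw [hlift, integral_haarAddCircle, AddCircle.integral_liftIoc_eq_intervalIntegral,
    intervalIntegral.integral_of_le (by linarith [hT.out]), smul_eq_mul, ← mul_assoc,
    mul_inv_cancel₀ hT.out.ne', one_mul]


/-! ### Step 4. Elementary inequalities -/

/-- `‖x + y + z‖² ≤ 3(‖x‖² + ‖y‖² + ‖z‖²)`. [folklore] -/
theorem norm_add_three_sq (x y z : ℂ) : ‖x + y + z‖ ^ 2 ≤ 3 * (‖x‖ ^ 2 + ‖y‖ ^ 2 + ‖z‖ ^ 2) := by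
  have h := norm_add₃_le (a := x) (b := y) (c := z)
  have hx := norm_nonneg x; have hy := norm_nonneg y; have hz := norm_nonneg z
  nlinarith [sq_nonneg (‖x‖ - ‖y‖), sq_nonneg (‖y‖ - ‖z‖), sq_nonneg (‖x‖ - ‖z‖), norm_nonneg (x + y + z)]

/-- Cauchy–Schwarz for a finite sum of products of complex numbers. -/
theorem norm_sum_mul_sq_le {ι : Type*} (s : Finset ι) (w d : ι → ℂ) :
    ‖∑ i ∈ s, w i * d i‖ ^ 2 ≤ (∑ i ∈ s, ‖w i‖ ^ 2) * ∑ i ∈ s, ‖d i‖ ^ 2 := by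
  calc ‖∑ i ∈ s, w i * d i‖ ^ 2 ≤ (∑ i ∈ s, ‖w i‖ * ‖d i‖) ^ 2 := by
        gcongr
        exact (norm_sum_le _ _).trans (le_of_eq (Finset.sum_congr rfl fun i _ ↦ norm_mul _ _))
    _ ≤ _ := Finset.sum_mul_sq_le_sq_mul_sq s _ _

/-- `|e^{-iau} - e^{-ibu}| ≤ |a-b|·|u|`. -/
theorem norm_cexp_sub_cexp_le (a b u : ℝ) :
    ‖cexp (-(I * a * u)) - cexp (-(I * b * u))‖ ≤ |a - b| * |u| := by
  have h1 : cexp (-(I * b * u)) = cexp (-(I * a * u)) * cexp (I * (((a - b) * u : ℝ) : ℂ)) := by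
    rw [← Complex.exp_add]; congr 1; push_cast; ring
  have h2 : ‖cexp (-(I * a * u))‖ = 1 := by
    rw [show -(I * (a : ℂ) * u) = I * (((-(a * u)) : ℝ) : ℂ) by push_cast; ring]
    exact norm_exp_I_mul_ofReal _
  calc ‖cexp (-(I * a * u)) - cexp (-(I * b * u))‖
      = ‖cexp (-(I * a * u)) * (1 - cexp (I * (((a - b) * u : ℝ) : ℂ)))‖ := by rw [mul_one_sub, ← h1]
    _ = ‖cexp (I * (((a - b) * u : ℝ) : ℂ)) - 1‖ := by rw [norm_mul, h2, one_mul, norm_sub_rev]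
    _ ≤ ‖(a - b) * u‖ := Real.norm_exp_I_mul_ofReal_sub_one_le
    _ = |a - b| * |u| := by rw [Real.norm_eq_abs, abs_mul]

/-- Taylor: `|2 sinh x − Σ_{m<n} (x^m − (−x)^m)/m!| ≤ 4·2^{-n}` for `|x| ≤ 1/2`, `n ≥ 1`. -/
theorem two_sinh_taylor {n : ℕ} (hn : 0 < n) {x : ℝ} (hx : |x| ≤ 1 / 2) :
    |2 * Real.sinh x - ∑ m ∈ Finset.range n, (x ^ m - (-x) ^ m) / m.factorial| ≤ 4 * (1 / 2) ^ n := by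
  have hx1 : |x| ≤ 1 := hx.trans (by norm_num)
  have hx1' : |-x| ≤ 1 := by rwa [abs_neg]
  have e1 := Real.exp_bound hx1 hn
  have e2 := Real.exp_bound hx1' hn
  have hratio : (n.succ : ℝ) / (n.factorial * n) ≤ 2 := by
    rw [div_le_iff₀ (by positivity)]
    have h1 : (1 : ℝ) ≤ n.factorial := by exact_mod_cast Nat.one_le_iff_ne_zero.mpr (Nat.factorial_ne_zero n)
    have h2 : (1 : ℝ) ≤ n := by exact_mod_cast hn
    push_cast
    nlinarith
  have hpow : |x| ^ n ≤ (1 / 2) ^ n := pow_le_pow_left₀ (abs_nonneg x) hx n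
  have hpow' : |-x| ^ n ≤ (1 / 2) ^ n := by rwa [abs_neg]
  have hnn : 0 ≤ |x| ^ n := pow_nonneg (abs_nonneg x) n
  have hnn' : 0 ≤ |-x| ^ n := pow_nonneg (abs_nonneg _) n
  have hrat0 : 0 ≤ (n.succ : ℝ) / (n.factorial * n) := by positivity
  have hsplit : 2 * Real.sinh x - ∑ m ∈ Finset.range n, (x ^ m - (-x) ^ m) / m.factorial =
      (Real.exp x - ∑ m ∈ Finset.range n, x ^ m / m.factorial)
        - (Real.exp (-x) - ∑ m ∈ Finset.range n, (-x) ^ m / m.factorial) := by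
    rw [Real.sinh_eq]
    simp only [sub_div, Finset.sum_sub_distrib]
    ring
  rw [hsplit]
  calc |(Real.exp x - ∑ m ∈ Finset.range n, x ^ m / m.factorial)
        - (Real.exp (-x) - ∑ m ∈ Finset.range n, (-x) ^ m / m.factorial)|
      ≤ |Real.exp x - ∑ m ∈ Finset.range n, x ^ m / m.factorial|
        + |Real.exp (-x) - ∑ m ∈ Finset.range n, (-x) ^ m / m.factorial| := abs_sub _ _
    _ ≤ |x| ^ n * (n.succ / (n.factorial * n)) + |-x| ^ n * (n.succ / (n.factorial * n)) := add_le_add e1 e2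
    _ ≤ (1 / 2) ^ n * 2 + (1 / 2) ^ n * 2 := by gcongr
    _ = 4 * (1 / 2) ^ n := by ring

/-- Reflection `n ↦ −n` of a sum over the symmetric integer interval `Icc (−K) K`. [folklore] -/
theorem sum_Icc_neg {β : Type*} [AddCommMonoid β] (K : ℕ) (f : ℤ → β) :
    ∑ n ∈ Finset.Icc (-(K : ℤ)) K, f n = ∑ k ∈ Finset.Icc (-(K : ℤ)) K, f (-k) := by
  apply Finset.sum_nbij' (fun k ↦ -k) (fun k ↦ -k)
  · intro k hk; simp only [Finset.mem_Icc] at hk ⊢; omega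
  · intro k hk; simp only [Finset.mem_Icc] at hk ⊢; omega
  · intro k _; simp
  · intro k _; simp
  · intro k _; simp

/-! ### Step 5. The monomial targets `u ↦ u^m · 𝟙_{[-1,1]}` -/

/-- target `g_m(u) = u^m` on `[-1,1]`, `0` elsewhere -/
noncomputable def gm (m : ℕ) : ℝ → ℂ := Set.indicator (Icc (-1 : ℝ) 1) (fun u ↦ (u : ℂ) ^ m)

/-- On `[−1,1]` the monomial target `gm m` is `u ↦ u^m`. -/
theorem gm_apply_of_mem {m : ℕ} {u : ℝ} (hu : u ∈ Icc (-1 : ℝ) 1) : gm m u = (u : ℂ) ^ m := by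
  simp [gm, hu]

/-- `‖gm m u‖ ≤ 1` everywhere. -/
theorem norm_gm_le (m : ℕ) (u : ℝ) : ‖gm m u‖ ≤ 1 := by
  unfold gm
  by_cases hu : u ∈ Icc (-1 : ℝ) 1
  · rw [indicator_of_mem hu, norm_pow, Complex.norm_real, Real.norm_eq_abs]
    exact pow_le_one₀ (abs_nonneg u) (abs_le.2 ⟨hu.1, hu.2⟩)
  · rw [indicator_of_notMem hu, norm_zero]; exact zero_le_one

/-- `‖gm m u‖² ≤ 𝟙_{[−1,1]}(u)`. -/
theorem norm_gm_sq_le_indicator (m : ℕ) (u : ℝ) :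
    ‖gm m u‖ ^ 2 ≤ Set.indicator (Icc (-1 : ℝ) 1) (fun _ ↦ (1 : ℝ)) u := by
  by_cases hu : u ∈ Icc (-1 : ℝ) 1
  · rw [indicator_of_mem hu]
    have := norm_gm_le m u
    have h0 := norm_nonneg (gm m u)
    nlinarith
  · simp [gm, hu]

/-- The monomial target `gm m` is measurable. -/
theorem measurable_gm (m : ℕ) : Measurable (gm m) :=
  ((Complex.continuous_ofReal.pow m).measurable).indicator measurableSet_Icc

/-- The monomial target `gm m` is in `L²` of every bounded interval `Ioc a b`. -/
theorem memLp_gm (m : ℕ) (a b : ℝ) : MemLp (gm m) 2 (volume.restrict (Ioc a b)) :=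
  MemLp.of_bound (measurable_gm m).aestronglyMeasurable 1 (Eventually.of_forall (norm_gm_le m))

/-- a trigonometric polynomial is continuous -/
theorem continuous_trigPoly (F : Finset ℤ) (c : ℤ → ℂ) (T : ℝ) :
    Continuous fun u : ℝ ↦ ∑ n ∈ F, c n * cexp (2 * Real.pi * I * n * u / T) := by
  fun_prop

/-- A trigonometric polynomial is bounded by the `ℓ¹` norm of its coefficients. -/
theorem norm_trigPoly_le (F : Finset ℤ) (c : ℤ → ℂ) (T u : ℝ) :
    ‖∑ n ∈ F, c n * cexp (2 * Real.pi * I * n * u / T)‖ ≤ ∑ n ∈ F, ‖c n‖ := by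
  refine (norm_sum_le _ _).trans (Finset.sum_le_sum fun n _ ↦ ?_)
  rw [norm_mul, show 2 * (Real.pi : ℂ) * I * n * u / T = I * (((2 * Real.pi * n * u / T : ℝ)) : ℂ) by push_cast; ring,
    norm_exp_I_mul_ofReal, mul_one]

/-- integrability of the squared synthesis error of `g_m` on any bounded interval -/
theorem integrableOn_gm_err (m : ℕ) (F : Finset ℤ) (c : ℤ → ℂ) (T a b : ℝ) :
    IntegrableOn (fun u ↦ ‖gm m u - ∑ n ∈ F, c n * cexp (2 * Real.pi * I * n * u / T)‖ ^ 2) (Ioc a b) := by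
  refine Measure.integrableOn_of_bounded (M := (1 + ∑ n ∈ F, ‖c n‖) ^ 2) measure_Ioc_lt_top.ne ?_ ?_
  · have hmeas : Measurable fun u ↦ ‖gm m u - ∑ n ∈ F, c n * cexp (2 * Real.pi * I * n * u / T)‖ ^ 2 :=
      ((measurable_gm m).sub (continuous_trigPoly F c T).measurable).norm.pow_const 2
    exact hmeas.aestronglyMeasurable
  · refine Eventually.of_forall fun u ↦ ?_
    rw [Real.norm_eq_abs, abs_pow, abs_norm]
    gcongr
    exact (norm_sub_le _ _).trans (add_le_add (norm_gm_le m u) (norm_trigPoly_le F c T u))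

/-- **Per-target synthesis.** For the period `T`: Fourier coefficients `c` of `g_m` with Bessel bound
`Σ_{|n|≤K} |c_n|² ≤ 2/T` for every `K`, and symmetric partial sums converging in `L²` of the period. -/
theorem gm_synthesis (m : ℕ) :
    ∃ c : ℤ → ℂ, (∀ K : ℕ, ∑ n ∈ Finset.Icc (-(K : ℤ)) K, ‖c n‖ ^ 2 ≤ 2 / T) ∧
      ∀ η : ℝ, 0 < η → ∃ K₀ : ℕ, ∀ K : ℕ, K₀ ≤ K →
        ∫ u in Ioc (-T / 2) (-T / 2 + T),
          ‖gm m u - ∑ n ∈ Finset.Icc (-(K : ℤ)) K, c n * cexp (2 * Real.pi * I * n * u / T)‖ ^ 2 < η := by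
  have hg := memLp_gm m (-T / 2) (-T / 2 + T)
  set x : Lp ℂ 2 (@haarAddCircle T hT) := (memLp_lift hg).toLp _ with hx
  refine ⟨fun n ↦ inner ℂ (fourierLp 2 n : Lp ℂ 2 (@haarAddCircle T hT)) x, fun K ↦ ?_, fun η hη ↦ ?_⟩
  · -- Bessel + `T‖x‖² = ∫ |g_m|² ≤ 2`
    have hB := orthonormal_fourier.sum_inner_products_le x (s := Finset.Icc (-(K : ℤ)) K)
    have hnorm : T * ‖x‖ ^ 2 = ∫ u in Ioc (-T / 2) (-T / 2 + T), ‖gm m u‖ ^ 2 := by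
      have h := norm_sq_sub_trigPoly hg ∅ (fun _ ↦ 0)
      simp only [Finset.sum_empty, sub_zero] at h
      rw [← h]
    have hle : ∫ u in Ioc (-T / 2) (-T / 2 + T), ‖gm m u‖ ^ 2 ≤ 2 := by
      calc ∫ u in Ioc (-T / 2) (-T / 2 + T), ‖gm m u‖ ^ 2
          ≤ ∫ u in Ioc (-T / 2) (-T / 2 + T), Set.indicator (Icc (-1 : ℝ) 1) (fun _ ↦ (1 : ℝ)) u := by
            apply integral_mono_of_nonneg (Eventually.of_forall fun u ↦ by positivity)
            · exact (integrable_indicator_iff measurableSet_Icc).2 integrableOn_const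
            · exact Eventually.of_forall (norm_gm_sq_le_indicator m)
        _ = volume.real (Ioc (-T / 2) (-T / 2 + T) ∩ Icc (-1 : ℝ) 1) := by
            rw [setIntegral_indicator measurableSet_Icc, setIntegral_const, smul_eq_mul, mul_one]
        _ ≤ volume.real (Icc (-1 : ℝ) 1) := measureReal_mono inter_subset_right measure_Icc_lt_top.ne
        _ = 2 := by rw [Real.volume_real_Icc_of_le (by norm_num)]; norm_num
    rw [le_div_iff₀ hT.out]
    calc (∑ n ∈ Finset.Icc (-(K : ℤ)) K, ‖inner ℂ (fourierLp 2 n : Lp ℂ 2 (@haarAddCircle T hT)) x‖ ^ 2) * T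
        ≤ ‖x‖ ^ 2 * T := mul_le_mul_of_nonneg_right hB hT.out.le
      _ ≤ 2 := by rw [mul_comm, hnorm]; exact hle
  · obtain ⟨K₀, hK₀⟩ := fourier_partial_sum_L2 x (ε := η / T) (div_pos hη hT.out)
    refine ⟨K₀, fun K hK ↦ ?_⟩
    rw [← norm_sq_sub_trigPoly hg]
    have := hK₀ K hK
    rwa [lt_div_iff₀ hT.out, mul_comm] at this

end Summit.RiemannHypothesis.RiemannHypothesis.Theorems.Splittings.TruncatedFourierSynthesisL2
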